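import Summits.MatrixMultiplication.MatrixMultiplication.Theorems.SoloInformedTranslateWorld

/-!
# Sign consistency: the counting step of Theorem 8.21

This work, §8.8 (T13)(b) step (3) / paper `C3-m2.md` §4 (3) (gen 107). Setting of `SoloInformedTranslateWorld`
(CohnUmans2013, arXiv:1207.6528, Def. 12; coprime case, every chart). After the shift rule and the re-gauge, a fixed
column `j` carries row signs `ε i` and column signs `δ k` with `ε i ≠ δ k` at every non-degenerate cell `(i,k)` outside a
sparse bad set (≤ 4μ bad rows per column, ≤ 2μ bad columns per row, ≤ μ degenerate rows and columns). The purely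
combinatorial conclusion, proved here over `Bool`-valued signs: if `10 μ < n` then `ε` is constant on the non-degenerate
rows and `δ` is the opposite constant on the non-degenerate columns (`exists_const_of_antiAligned`). This is what turns
the locked data into EXACT twisted translates `a ∼ f i + g j`, `b ∼ l k - g j`.
References: this work §8.8 (T13); CohnUmans2013 Def. 12.
-/

namespace Summit.MatrixMultiplication.MatrixMultiplication.Theorems.TwistedTPP

namespace FibreLines

/-- Two `Bool` signs both different from a third one are equal. -/
theorem Bool.eq_of_ne_of_ne {a b c : Bool} (ha : a ≠ c) (hb : b ≠ c) : a = b := by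
  cases a <;> cases b <;> cases c <;> simp_all

/-- A set of size `≤ μ < n` in a type of size `n` has a non-member. -/
theorem exists_notMem_of_card_le {ι : Type*} [Fintype ι] [DecidableEq ι] {μ : ℕ} (S : Finset ι) (hS : S.card ≤ μ)
    (hμ : μ < Fintype.card ι) : ∃ k, k ∉ S := by
  by_contra hc
  push Not at hc
  have hU : S = Finset.univ := Finset.eq_univ_of_forall hc
  rw [hU, Finset.card_univ] at hS
  omega

/-- The good part of a line is large: removing `≤ μ` degenerate indices and `≤ b` bad ones from `n` leaves `≥ n - μ - b`. -/
theorem card_good_ge {ι : Type*} [Fintype ι] [DecidableEq ι] {μ b : ℕ} (Deg : Finset ι) (hDeg : Deg.card ≤ μ)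
    (P : ι → Prop) [DecidablePred P] (hbad : ((Finset.univ \ Deg).filter P).card ≤ b) :
    Fintype.card ι ≤ ((Finset.univ \ Deg).filter (fun i => ¬ P i)).card + μ + b := by
  have h1 : ((Finset.univ \ Deg).filter P).card + ((Finset.univ \ Deg).filter (fun i => ¬ P i)).card =
      (Finset.univ \ Deg).card := Finset.card_filter_add_card_filter_not _
  have h2 : (Finset.univ \ Deg).card = Fintype.card ι - Deg.card := by
    rw [Finset.card_univ_sdiff]
  have h3 : Deg.card ≤ Fintype.card ι := by
    calc Deg.card ≤ (Finset.univ : Finset ι).card := Finset.card_le_univ _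
      _ = Fintype.card ι := Finset.card_univ
  omega

/-- Two large subsets of a finite type intersect. -/
theorem exists_mem_inter_of_card {ι : Type*} [Fintype ι] [DecidableEq ι] (S T : Finset ι)
    (h : Fintype.card ι < S.card + T.card) : ∃ i, i ∈ S ∧ i ∈ T := by
  have h1 := Finset.card_union_add_card_inter S T
  have h2 : (S ∪ T).card ≤ Fintype.card ι := by
    calc (S ∪ T).card ≤ (Finset.univ : Finset ι).card := Finset.card_le_univ _
      _ = Fintype.card ι := Finset.card_univ
  have h3 : 0 < (S ∩ T).card := by omega
  obtain ⟨i, hi⟩ := Finset.card_pos.mp h3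
  exact ⟨i, (Finset.mem_inter.mp hi).1, (Finset.mem_inter.mp hi).2⟩

/-- **Sign consistency (the counting step of Theorem 8.21).** Row signs `ε`, column signs `δ`, anti-aligned (`ε i ≠ δ k`)
at every non-degenerate good cell; bad cells: `≤ 4μ` per non-degenerate column and `≤ 2μ` per non-degenerate row;
`≤ μ` degenerate rows and columns; `10 μ < n`. Then `ε` is a constant `e` on non-degenerate rows and `δ` is the opposite
constant on non-degenerate columns. [this work, §8.8 (T13)(b)(3)] -/
theorem exists_const_of_antiAligned {ι : Type*} [Fintype ι] [DecidableEq ι] (μ : ℕ)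
    (hn : 10 * μ < Fintype.card ι) (Ideg Kdeg : Finset ι) (hI : Ideg.card ≤ μ) (hK : Kdeg.card ≤ μ)
    (Bad : ι → ι → Prop) [∀ i k, Decidable (Bad i k)]
    (hcol : ∀ k, k ∉ Kdeg → ((Finset.univ \ Ideg).filter (fun i => Bad i k)).card ≤ 4 * μ)
    (hrow : ∀ i, i ∉ Ideg → ((Finset.univ \ Kdeg).filter (fun k => Bad i k)).card ≤ 2 * μ)
    (ε δ : ι → Bool) (h : ∀ i, i ∉ Ideg → ∀ k, k ∉ Kdeg → ¬ Bad i k → ε i ≠ δ k) :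
    ∃ e : Bool, (∀ i, i ∉ Ideg → ε i = e) ∧ (∀ k, k ∉ Kdeg → δ k ≠ e) := by
  have hμ : μ < Fintype.card ι := by omega
  obtain ⟨k₀, hk₀⟩ := exists_notMem_of_card_le Kdeg hK hμ
  -- good rows of a non-degenerate column
  let Good : ι → Finset ι := fun k => (Finset.univ \ Ideg).filter (fun i => ¬ Bad i k)
  have hGood : ∀ k, k ∉ Kdeg → Fintype.card ι ≤ (Good k).card + μ + 4 * μ := fun k hk =>
    card_good_ge Ideg hI (fun i => Bad i k) (hcol k hk)
  have memGood : ∀ {k i}, i ∈ Good k → i ∉ Ideg ∧ ¬ Bad i k := by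
    intro k i hi
    simp only [Good, Finset.mem_filter, Finset.mem_sdiff, Finset.mem_univ, true_and] at hi
    exact hi
  -- all non-degenerate column signs agree with δ k₀
  have hδ : ∀ k, k ∉ Kdeg → δ k = δ k₀ := by
    intro k hk
    have hlt : Fintype.card ι < (Good k).card + (Good k₀).card := by
      have := hGood k hk; have := hGood k₀ hk₀; omega
    obtain ⟨i, hi, hi₀⟩ := exists_mem_inter_of_card (Good k) (Good k₀) hlt
    obtain ⟨hiI, hib⟩ := memGood hi
    obtain ⟨-, hib₀⟩ := memGood hi₀
    exact Bool.eq_of_ne_of_ne (h i hiI k hk hib).symm (h i hiI k₀ hk₀ hib₀).symm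
  refine ⟨!(δ k₀), ?_, ?_⟩
  · intro i hi
    -- row i has a good non-degenerate column
    have hc := card_good_ge Kdeg hK (fun k => Bad i k) (hrow i hi)
    have hpos : 0 < ((Finset.univ \ Kdeg).filter (fun k => ¬ Bad i k)).card := by omega
    obtain ⟨k, hk⟩ := Finset.card_pos.mp hpos
    simp only [Finset.mem_filter, Finset.mem_sdiff, Finset.mem_univ, true_and] at hk
    have hne := h i hi k hk.1 hk.2
    rw [hδ k hk.1] at hne
    revert hne; cases ε i <;> cases δ k₀ <;> simp
  · intro k hk
    rw [hδ k hk]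
    cases δ k₀ <;> simp

end FibreLines

end Summit.MatrixMultiplication.MatrixMultiplication.Theorems.TwistedTPP
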